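import Mathlib.LinearAlgebra.Matrix.Adjugate
import Literature.Analysis.FluidPDE.OnsagerBDSVPerturbationFlowBounds
import HarnessLib

/-!
# The BDSV scheme: the energy estimate (Prop. 6.2) decomposed along its printed proof

Buckmaster–De Lellis–Székelyhidi–Vicol (BDSV), *Onsager's conjecture for admissible weak
solutions*, CPAM 72 (2019) = arXiv:1701.08678. The named fact `BDSV.energyEstimate`
(`OnsagerBDSVPerturbation.lean`, fact F₇ of the perturbation stage) is Prop. 6.2:
`|e(t) - ∫_{T³} |v_{q+1}|² dx - δ_{q+2}/2| ≲ δ_q^{1/2} δ_{q+1}^{1/2} λ_q^{1+2α} / λ_{q+1}`.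
Its half-page proof (§6.2) is an identity plus three estimates, each resting on a sizeable part
of §5 and of the appendices. This file DECOMPOSES the fact along exactly these lines into three
named facts G₁–G₃ and PROVES everything else, in particular the assembly
`BDSV.energyEstimate_of_parts : G₁ → G₂ → G₃ → BDSV.energyEstimate`:

* the identity (proved here): `∫|v_{q+1}|² = ∫|v̄_q|² + 2∫ w_{q+1}·v̄_q + ∫|w_{q+1}|²`,
  `∫|w_{q+1}|² = ∫|w_o|² + ∫(2 w_o·w_c + |w_c|²)` for the split `w_{q+1} = w_o + w_c` of §5.3,
  and `3ρ_q(t) = e(t) - δ_{q+2}/2 - ∫|v̄_q|²` (definition of `ρ_q`, §5.2);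
* G₀, the bounds `δ_{q+1}/(8λ_q^α) ≤ ρ_q(t) ≤ δ_{q+1}` of Lemma 5.4, is already PROVED in the tree
  (`OnsagerBDSVPerturbationFlowBounds.lean`: `BDSV.PerturbationHypotheses.le_rhoQ`, `.rhoQ_le`
  from the energy gap (5.2), with the parameter inequality `4δ_{q+2} ≤ δ_{q+1}λ_q^{-α}` of
  `BDSV.exists_threshold_four_amp`); here it is only threaded into the common prefix
  (`BDSV.stageFact_rhoQ_bounds`). It makes `ρ_q > 0`, whence the construction is smooth
  (`BDSV.SmoothData`, through `BDSV.PerturbationHypotheses.toSmoothData`, which factors the inline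
  construction of `BDSV.newTriple_isEulerReynolds_holds`);
* G₁ `BDSV.energy_crossTerm` = the first estimate of the proof:
  `|∫ w_{q+1}·v̄_q| ≲ δ_q^{1/2} δ_{q+1}^{1/2} λ_q λ_{q+1}^{-1}` (by parts with the curl form
  (5.28), then the bounds of Prop. 5.7 on `∇Φ_i` and `b_{i,k}`);
* G₂ `BDSV.energy_correctorTerm` = the second estimate:
  `|∫ 2w_o·w_c + |w_c|²| ≲ δ_{q+1} ℓ^{-1} λ_{q+1}^{-1}` (the bounds of Cor. 5.8 on `w_o`, `w_c`);
* G₃ `BDSV.energy_principalTerm` = the last paragraph: `|∫|w_o|² - ∑_i ∫ tr R_{q,i}|`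
  `= |∫|w_o|² - 3ρ_q| ≲ δ_{q+1} δ_q^{1/2} λ_q λ_{q+1}^{-1}` (the expansion of `w_{o,i} ⊗ w_{o,i}`
  of §6.1.3, the stationary-phase estimate (C.1) of Prop. C.2 with `‖e_{q,i}‖_N ≲ δ_{q+1} ℓ^{-N}`
  (Prop. 5.7, Lemma 5.4), and the choice of `N`).

G₁–G₃ carry the quantifier prefix of the facts F₆ (`BDSV.stressEstimate`) and F₇
(`BDSV.energyEstimate`) of the perturbation stage (also that of F₅, up to its unused constant `C`;
F₄ has an extra `∃ M` in front), which is abstracted once as the combinator `BDSV.StageFact`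
(with `BDSV.energyEstimate ↔ StageFact _` by `Iff.rfl`, and the bookkeeping lemmas
`StageFact.and`, `StageFact.mono` taking minima of the thresholds `α₀`, maxima of `N̄`, `a₀` and of
the constants); the assembly then compares the three scales with the target one
(`λ_q ≤ λ_q^{1+2α}`, `δ_{q+1} ℓ^{-1} = δ_{q+1}^{1/2} δ_q^{1/2} λ_q^{1+3α/2}`, `δ_{q+1} ≤ δ_{q+1}^{1/2}`).

## Design choices

* The principal part `w_o` (5.20) is `∑_i ρ_{q,i}^{1/2} adj(∇Φ_i) W(R̃_{q,i}, n_{q+1} Φ_i)`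
  (`BDSV.principalPart`), with the adjugate `adj ∇Φ_i = cof ∇Φ_iᵀ` in place of `(∇Φ_i)⁻¹`: the
  two agree because `det ∇Φ_i = 1` for the flow of the divergence-free `v̄_q`, which is the
  identity `cof ∇Φᵀ (curl U)(Φ) = ∇Φ⁻¹ (curl U)(Φ)` the source uses to reach the curl form (5.28);
  the adjugate is polynomial in `∇Φ_i`, so `w_o` is smooth with the rest of the construction.
  The corrector is `w_c := w_{q+1} - w_o` (`BDSV.correctorPart`), so that (5.28)
  `w_{q+1} = w_o + w_c` holds by definition and the explicit formula (5.27) for `w_c` becomes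
  part of the proof of G₂.
* Scales are those printed at each step of the source (G₂ in its `ℓ`-form); all constants `C` may
  depend on everything quantified before them, thresholds `a₀` absorb the rest, as in F₄–F₇.

## What is not here

The proofs of G₁–G₃: G₁ from integration by parts on `T³`, Lemma 5.4 (`‖∇Φ_i - Id‖₀ ≤ 1/2`
on `supp η_i`, `‖ρ_{q,i}‖₀ ≤ δ_{q+1}/c₀`, `R̃_{q,i} ∈ 𝒩`) and App. B; G₂ from the bounds of
Cor. 5.8 on `w_o`, `w_c` and (6.6) `ℓ λ_{q+1} ≥ 1`; G₃ from `det ∇Φ_i = 1`, the expansion of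
`w_{o,i} ⊗ w_{o,i}` (§6.1.3) through the Fourier series of `W ⊗ W` (§5.1), Prop. C.2 (C.1) and
Prop. 5.7 at order `N` — each the subject of later files, after which
`BDSV.energyEstimate_holds` follows from `BDSV.energyEstimate_of_parts`.

## References

* T. Buckmaster, C. De Lellis, L. Székelyhidi Jr., V. Vicol, *Onsager's conjecture for admissible
  weak solutions*, Comm. Pure Appl. Math. 72 (2019) 229–274 = arXiv:1701.08678: §5.1 Lemma 5.1;
  §5.2 (`ρ_q`, `ρ_{q,i}`, `R_{q,i}`, (5.17)), Lemma 5.4; §5.3 (5.20), (5.27), (5.28); §5.5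
  Prop. 5.7, Cor. 5.8; §6.1.1 (6.6), §6.1.3; §6.2 Prop. 6.2 and its proof; App. C Prop. C.2 (C.1).
-/

open MeasureTheory Set
open scoped NNReal ENNReal ContDiff InnerProductSpace Matrix Matrix.Norms.Elementwise

noncomputable section

namespace Literature.Analysis.FluidPDE

namespace BDSV

open FunctionSpaces FunctionSpaces.Torus

/-- The flat three-torus `T³ = (ℝ/ℤ)³`, local notation. -/
local notation "𝕋³" => UnitAddTorus (Fin 3)

/-- Euclidean `ℝ³`, local notation. -/
local notation "ℝ³" => EuclideanSpace ℝ (Fin 3)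

/-- Real `3 × 3` matrices, local notation. -/
local notation "𝕄" => Matrix (Fin 3) (Fin 3) ℝ

/-! ## The split `w_{q+1} = w_o + w_c` of §5.3 -/

section Split

variable (P : Params) (S : Setting)

/-- **The principal part of the perturbation** (5.20),
`w_o = ∑_i ρ_{q,i}^{1/2} (∇Φ_i)⁻¹ W(R̃_{q,i}, λ_{q+1} Φ_i)`, with the inverse `(∇Φ_i)⁻¹` written as
the adjugate `adj ∇Φ_i = cof ∇Φ_iᵀ` (equal to it since `det ∇Φ_i = 1` for the flow of the
divergence-free field `v̄_q` — the identity `cof ∇Φᵀ (curl U)(Φ) = ∇Φ⁻¹ (curl U)(Φ)` of §5.3 used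
for (5.28)), and the `1`-periodic Mikado profile evaluated at `n_{q+1} Φ_i` (`λ_{q+1} = 2π n_{q+1}`,
cf. `BDSV.potential`). [cite: BuckmasterEtAl2018, §5.3 (5.20)] -/
def principalPart (𝔚 : MikadoDatum mikadoRadius) (η : ℕ → ℝ → 𝕋³ → ℝ) (D : ℕ → ℝ → 𝕋³ → ℝ³)
    (t : ℝ) (x : 𝕋³) : ℝ³ :=
  ∑ i ∈ Finset.range (cutoffCount S.T (P.τ S.q)),
    sqrtRhoI P S η i t x •
      Matrix.toEuclideanLin (gradPhi D i t x).adjugate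
        (𝔚.W (tildeR P S η D i t x) (P.freqNat (S.q + 1) • phiPoint D i t x))

/-- **The corrector** `w_c := w_{q+1} - w_o` of the split (5.28) `w_{q+1} = w_o + w_c`: the
curl form `w_{q+1} = n_{q+1}⁻¹ curl Z` (`BDSV.perturbation`) minus its principal part (5.20); by
the pull-back identity `curl (∇Φᵀ U(·, Φ)) = adj ∇Φ (curl_y U)(·, Φ) + (terms with ∇ₓU)` it is the
sum (5.27) of the terms carrying one derivative of the slow variables and a factor `λ_{q+1}⁻¹`.
[cite: BuckmasterEtAl2018, §5.3 (5.27)–(5.28)] -/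
def correctorPart (𝔚 : MikadoDatum mikadoRadius) (η : ℕ → ℝ → 𝕋³ → ℝ) (D : ℕ → ℝ → 𝕋³ → ℝ³)
    (t : ℝ) (x : 𝕋³) : ℝ³ :=
  perturbation P S 𝔚 η D t x - principalPart P S 𝔚 η D t x

/-- (5.28): `w_{q+1} = w_o + w_c` (by definition of the corrector). [cite: BuckmasterEtAl2018, §5.3 (5.28)] -/
theorem perturbation_eq_principalPart_add_correctorPart (𝔚 : MikadoDatum mikadoRadius)
    (η : ℕ → ℝ → 𝕋³ → ℝ) (D : ℕ → ℝ → 𝕋³ → ℝ³) (t : ℝ) (x : 𝕋³) :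
    perturbation P S 𝔚 η D t x = principalPart P S 𝔚 η D t x + correctorPart P S 𝔚 η D t x := by
  rw [correctorPart, add_sub_cancel]

end Split

/-! ## The common quantifier prefix of the stage facts -/

section Prefix

/-- **The quantifier prefix shared by the facts of the perturbation stage** (F₆ `stressEstimate`
and F₇ `energyEstimate` of `OnsagerBDSVPerturbation.lean` — F₅ up to its unused constant, F₄ up to
an extra `∃ M` — and G₁–G₃ below), as a combinator on their bodies `B`: "for every
Mikado datum `𝔚` and cut-off constant `c₀ > 0` (with derivative constants `C_η`), all
`0 < β < 1/3`, `1 < b < (1-β)/(2β)`, there is `α₀ > 0` such that for `0 < α < α₀` there is a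
number of derivatives `N̄` such that for all input constants `C_in, C₀` there are a constant `C`
and a threshold `a₀ > 1` such that for `a ≥ a₀`, every setting `S = (T, e, q, v̄_q, p̄_q, R̊̄_q)`
satisfying the standing hypotheses (`BDSV.PerturbationHypotheses`) and all construction data
`𝒟` (cut-offs and backward flows), `B(𝔚, (β, α, a, b), C, S, 𝒟)` holds" — the structure
"`α` sufficiently small, `N` suitably chosen, `a` sufficiently large, implicit constants
depending on everything fixed before" of §§5–6. [cite: BuckmasterEtAl2018, §2.6 and §6 (structure of the constants)] -/
def StageFact (B : MikadoDatum mikadoRadius → (P : Params) → ℝ → (S : Setting) → (c₀ : ℝ) →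
    (Cη : ℕ → ℕ → ℝ) → PerturbationData P S c₀ Cη → Prop) : Prop :=
  ∀ (𝔚 : MikadoDatum mikadoRadius) (c₀ : ℝ), 0 < c₀ → ∀ Cη : ℕ → ℕ → ℝ,
    ∀ β : ℝ, 0 < β → β < 1 / 3 → ∀ b : ℝ, 1 < b → b < (1 - β) / (2 * β) →
      ∃ α₀ : ℝ, 0 < α₀ ∧ ∀ α : ℝ, 0 < α → α < α₀ → ∃ Nbar : ℕ, ∀ Cin C₀ : ℝ,
        ∃ C a₀ : ℝ, 1 < a₀ ∧ ∀ a : ℝ, a₀ ≤ a → ∀ S : Setting,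
          PerturbationHypotheses ⟨β, α, a, b⟩ S Nbar Cin C₀ →
            ∀ 𝒟 : PerturbationData ⟨β, α, a, b⟩ S c₀ Cη, B 𝔚 ⟨β, α, a, b⟩ C S c₀ Cη 𝒟

/-- `BDSV.energyEstimate` is the stage fact with body "(2.24c) = Prop. 6.2 on `[0,T]` with
constant `C`" (definitionally). [cite: BuckmasterEtAl2018, Prop. 6.2] -/
theorem energyEstimate_iff_stageFact :
    energyEstimate ↔ StageFact fun 𝔚 P C S _ _ 𝒟 => ∀ t ∈ Icc 0 S.T,
      |S.e t - (∫ x, ‖newVelocity P S 𝔚 𝒟.cut.η 𝒟.D t x‖ ^ 2) - amp P.β P.a P.b (S.q + 2) / 2| ≤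
        C * (Real.sqrt (amp P.β P.a P.b S.q) * Real.sqrt (amp P.β P.a P.b (S.q + 1)) *
          freq P.a P.b S.q ^ (1 + 2 * P.α) * (freq P.a P.b (S.q + 1))⁻¹) :=
  Iff.rfl

variable {A B : MikadoDatum mikadoRadius → (P : Params) → ℝ → (S : Setting) → (c₀ : ℝ) →
    (Cη : ℕ → ℕ → ℝ) → PerturbationData P S c₀ Cη → Prop}

/-- **Conjunction of stage facts**: two stage facts whose bodies are monotone in the constant hold
simultaneously along one prefix (the smaller threshold `α₀`, the larger `N̄`, `C` and `a₀`;
`BDSV.PerturbationHypotheses.of_le`). [folklore] -/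
theorem StageFact.and (hA : StageFact A) (hB : StageFact B)
    (mA : ∀ 𝔚 P C C' S c₀ Cη 𝒟, 1 ≤ P.a → C ≤ C' → A 𝔚 P C S c₀ Cη 𝒟 → A 𝔚 P C' S c₀ Cη 𝒟)
    (mB : ∀ 𝔚 P C C' S c₀ Cη 𝒟, 1 ≤ P.a → C ≤ C' → B 𝔚 P C S c₀ Cη 𝒟 → B 𝔚 P C' S c₀ Cη 𝒟) :
    StageFact fun 𝔚 P C S c₀ Cη 𝒟 => A 𝔚 P C S c₀ Cη 𝒟 ∧ B 𝔚 P C S c₀ Cη 𝒟 := by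
  intro 𝔚 c₀ hc₀ Cη β hβ hβ' b hb hb'
  obtain ⟨αA, hαA, hA⟩ := hA 𝔚 c₀ hc₀ Cη β hβ hβ' b hb hb'
  obtain ⟨αB, hαB, hB⟩ := hB 𝔚 c₀ hc₀ Cη β hβ hβ' b hb hb'
  refine ⟨min αA αB, lt_min hαA hαB, fun α hα hαlt => ?_⟩
  obtain ⟨NA, hA⟩ := hA α hα (lt_of_lt_of_le hαlt (min_le_left _ _))
  obtain ⟨NB, hB⟩ := hB α hα (lt_of_lt_of_le hαlt (min_le_right _ _))
  refine ⟨max NA NB, fun Cin C₀ => ?_⟩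
  obtain ⟨CA, aA, haA, hA⟩ := hA Cin C₀
  obtain ⟨CB, aB, haB, hB⟩ := hB Cin C₀
  refine ⟨max CA CB, max aA aB, lt_max_of_lt_left haA, fun a ha S H 𝒟 => ⟨?_, ?_⟩⟩
  · have ha1 : (1 : ℝ) ≤ a := haA.le.trans ((le_max_left _ _).trans ha)
    exact mA 𝔚 ⟨β, α, a, b⟩ CA (max CA CB) S c₀ Cη 𝒟 ha1 (le_max_left _ _)
      (hA a ((le_max_left _ _).trans ha) S (H.of_le (le_max_left _ _)) 𝒟)
  · have ha1 : (1 : ℝ) ≤ a := haB.le.trans ((le_max_right _ _).trans ha)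
    exact mB 𝔚 ⟨β, α, a, b⟩ CB (max CA CB) S c₀ Cη 𝒟 ha1 (le_max_right _ _)
      (hB a ((le_max_right _ _).trans ha) S (H.of_le (le_max_right _ _)) 𝒟)

/-- **Consequence along the prefix**: if, for all admissible parameters (`c₀ > 0`, `0 < β < 1/3`,
`1 < b`, `0 < α`, `1 < a`) and all data satisfying the standing hypotheses, the body `A` with
constant `C` implies the body `B` with constant `g C`, then the stage fact for `A` gives the one
for `B`. [folklore] -/
theorem StageFact.mono (g : ℝ → ℝ)
    (h : ∀ 𝔚 P C S c₀ Cη 𝒟, 0 < c₀ → 0 < P.β → P.β < 1 / 3 → 1 < P.b → 0 < P.α → 1 < P.a →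
      (∃ (Nbar : ℕ) (Cin C₀ : ℝ), PerturbationHypotheses P S Nbar Cin C₀) →
        A 𝔚 P C S c₀ Cη 𝒟 → B 𝔚 P (g C) S c₀ Cη 𝒟)
    (hA : StageFact A) : StageFact B := by
  intro 𝔚 c₀ hc₀ Cη β hβ hβ' b hb hb'
  obtain ⟨α₀, hα₀, hA⟩ := hA 𝔚 c₀ hc₀ Cη β hβ hβ' b hb hb'
  refine ⟨α₀, hα₀, fun α hα hαlt => ?_⟩
  obtain ⟨Nbar, hA⟩ := hA α hα hαlt
  refine ⟨Nbar, fun Cin C₀ => ?_⟩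
  obtain ⟨C, a₀, ha₀, hA⟩ := hA Cin C₀
  refine ⟨g C, a₀, ha₀, fun a ha S H 𝒟 => ?_⟩
  exact h 𝔚 ⟨β, α, a, b⟩ C S c₀ Cη 𝒟 hc₀ hβ hβ' hb hα (lt_of_lt_of_le ha₀ ha) ⟨Nbar, Cin, C₀, H⟩
    (hA a ha S H 𝒟)

end Prefix

/-! ## The three named facts -/

section Facts

/-- **The cross term of the energy** (BDSV, proof of Prop. 6.2, first estimate: "By integrating
by parts once and using the identity [(5.28), the curl form of `w_{q+1}`] and the estimates [of
Prop. 5.7 on `∇Φ_i` and `b_{i,k}`] we obtain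
`|∫_{T³} w_{q+1}·v̄_q dx| = ∑_i ∑_{k≠0} ‖∇Φ_iᵀ (ik × b_k)/|k|²‖₀ ‖v̄_q‖₁ ≲ δ_q^{1/2} δ_{q+1}^{1/2} λ_q / λ_{q+1}`"
— the middle expression standing for `λ_{q+1}⁻¹ ∑ ‖…‖₀ ‖v̄_q‖₁ ≥ λ_{q+1}⁻¹ |∫ Z·curl v̄_q|`), along
the common prefix (`BDSV.StageFact`), for the perturbation `w_{q+1}` of (5.28)
(`BDSV.perturbation`) and every `t ∈ [0,T]`.
[cite: BuckmasterEtAl2018, Prop. 6.2 (proof, estimate of ∫ w_{q+1}·v̄_q)] -/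
def energy_crossTerm : Prop :=
  StageFact fun 𝔚 P C S _ _ 𝒟 => ∀ t ∈ Icc 0 S.T,
    |∫ x, ⟪perturbation P S 𝔚 𝒟.cut.η 𝒟.D t x, S.vbar t x⟫_ℝ| ≤
      C * (Real.sqrt (amp P.β P.a P.b S.q) * Real.sqrt (amp P.β P.a P.b (S.q + 1)) *
        freq P.a P.b S.q * (freq P.a P.b (S.q + 1))⁻¹)

/-- **The corrector terms of the energy** (BDSV, proof of Prop. 6.2, second estimate: "Using
[the estimates of Cor. 5.8 on `w_o` and `w_c`] yields `|∫_{T³} 2w_o·w_c + |w_c|² dx| ≲ δ_{q+1}/(ℓ λ_{q+1})`",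
Cor. 5.8 giving `‖w_o‖₀ ≤ (M/4) δ_{q+1}^{1/2}` and `‖w_c‖₀ ≲ δ_{q+1}^{1/2} ℓ⁻¹ λ_{q+1}⁻¹`, and
(6.6) `ℓ λ_{q+1} ≥ 1`), along the common prefix, for the split `w_{q+1} = w_o + w_c`
(`BDSV.principalPart`, `BDSV.correctorPart`) and every `t ∈ [0,T]`; `ℓ = BDSV.mollScale`.
[cite: BuckmasterEtAl2018, Prop. 6.2 (proof, estimate of ∫ 2w_o·w_c + |w_c|²)] -/
def energy_correctorTerm : Prop :=
  StageFact fun 𝔚 P C S _ _ 𝒟 => ∀ t ∈ Icc 0 S.T,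
    |∫ x, (2 * ⟪principalPart P S 𝔚 𝒟.cut.η 𝒟.D t x, correctorPart P S 𝔚 𝒟.cut.η 𝒟.D t x⟫_ℝ +
        ‖correctorPart P S 𝔚 𝒟.cut.η 𝒟.D t x‖ ^ 2)| ≤
      C * (amp P.β P.a P.b (S.q + 1) * (mollScale P.β P.α P.a P.b S.q)⁻¹ *
        (freq P.a P.b (S.q + 1))⁻¹)

/-- **The principal term of the energy** (BDSV, proof of Prop. 6.2, last paragraph: by the
expansion of `w_{o,i} ⊗ w_{o,i}` of §6.1.3,
`∫|w_o|² = ∑_i ∫ tr R_{q,i} + ∫ ∑_{i,k≠0} ρ_{q,i} tr(∇Φ_i⁻¹ C_k(R̃_{q,i}) ∇Φ_i⁻ᵀ) e^{iλ_{q+1}k·Φ_i}`,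
where `∑_i ∫ tr R_{q,i} = 3∑_i ∫ρ_{q,i} = 3ρ_q(t)`; with `e_{q,i} := ρ_{q,i} ∇Φ_i⁻¹ tr C_k(R̃_i) ∇Φ_i⁻ᵀ`,
"`‖e_{q,i}‖_N ≲ δ_{q+1} ℓ^{-N}`" (Prop. 5.7, Lemma 5.4), "at any given time at most two `e_{q,i}`
are nonvanishing", and (C.1) of Prop. C.2, the oscillatory term is
`≲ ∑_{k≠0} δ_{q+1} ℓ^{-N}/(λ_{q+1}^N |k|^N)`, where "we can choose `N` such that
`δ_{q+1} ℓ^{-N}/λ_{q+1}^N ≤ δ_{q+1} δ_q^{1/2} λ_q/λ_{q+1}`", `N > 4`, `a` large):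
`|∫_{T³} |w_o(x,t)|² dx - 3ρ_q(t)| ≲ δ_{q+1} δ_q^{1/2} λ_q λ_{q+1}⁻¹`, along the common prefix, for
`w_o = BDSV.principalPart` and every `t ∈ [0,T]`.
[cite: BuckmasterEtAl2018, Prop. 6.2 (proof, last paragraph) and Prop. C.2 (C.1)] -/
def energy_principalTerm : Prop :=
  StageFact fun 𝔚 P C S _ _ 𝒟 => ∀ t ∈ Icc 0 S.T,
    |(∫ x, ‖principalPart P S 𝔚 𝒟.cut.η 𝒟.D t x‖ ^ 2) - 3 * rhoQ P S t| ≤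
      C * (amp P.β P.a P.b (S.q + 1) * Real.sqrt (amp P.β P.a P.b S.q) * freq P.a P.b S.q *
        (freq P.a P.b (S.q + 1))⁻¹)

end Facts

/-! ## Smoothness of the split -/

section Smooth

variable {S' : Set ℝ}

/-- The determinant of a matrix field with jointly smooth entries is jointly smooth (Leibniz
formula). [folklore] -/
theorem isSmoothSpaceTimeOn_det {A : ℝ → 𝕋³ → 𝕄}
    (hA : ∀ i j, IsSmoothSpaceTimeOn S' (fun t x => A t x i j)) :
    IsSmoothSpaceTimeOn S' (fun t x => (A t x).det) := by
  have h : (fun t x => (A t x).det) = fun t x =>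
      ∑ σ : Equiv.Perm (Fin 3), ((Equiv.Perm.sign σ : ℤ) : ℝ) * ∏ i, A t x (σ i) i := by
    funext t x
    rw [Matrix.det_apply]
    refine Finset.sum_congr rfl fun σ _ => ?_
    rw [Units.smul_def, zsmul_eq_mul]
  rw [h]
  refine IsSmoothSpaceTimeOn.sum fun σ _ => ?_
  have hp : IsSmoothSpaceTimeOn S' (fun t x => ∏ i, A t x (σ i) i) := by
    have hl : stLift (fun t x => ∏ i, A t x (σ i) i) =
        fun z => ∏ i, stLift (fun t x => A t x (σ i) i) z := by
      funext z
      rfl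
    unfold IsSmoothSpaceTimeOn
    rw [hl]
    exact contDiffOn_prod fun i _ => hA (σ i) i
  exact (isSmoothSpaceTimeOn_const (isSmooth_const _) _).mul hp

/-- The adjugate of a matrix field with jointly smooth entries has jointly smooth entries (each is
a determinant of such a field with one row replaced by a constant one). [folklore] -/
theorem isSmoothSpaceTimeOn_adjugate {A : ℝ → 𝕋³ → 𝕄}
    (hA : ∀ i j, IsSmoothSpaceTimeOn S' (fun t x => A t x i j)) (i j : Fin 3) :
    IsSmoothSpaceTimeOn S' (fun t x => (A t x).adjugate i j) := by
  have h : (fun t x => (A t x).adjugate i j) =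
      fun t x => ((A t x).updateRow j (Pi.single i 1)).det := by
    funext t x
    exact Matrix.adjugate_apply _ _ _
  rw [h]
  refine isSmoothSpaceTimeOn_det fun k l => ?_
  by_cases hk : k = j
  · subst hk
    have hc : (fun t x => (A t x).updateRow k (Pi.single i 1) k l) =
        fun _ _ => (Pi.single i 1 : Fin 3 → ℝ) l := by
      funext t x
      rw [Matrix.updateRow_self]
    rw [hc]
    exact isSmoothSpaceTimeOn_const (isSmooth_const _) _
  · have hc : (fun t x => (A t x).updateRow j (Pi.single i 1) k l) = fun t x => A t x k l := by
      funext t x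
      rw [Matrix.updateRow_ne hk]
    rw [hc]
    exact hA k l

variable {P : Params} {S : Setting} {η : ℕ → ℝ → 𝕋³ → ℝ} {D : ℕ → ℝ → 𝕋³ → ℝ³}

namespace SmoothData

variable (h : SmoothData P S η D)
include h

/-- The Mikado factor `W(R̃_{q,i}, n_{q+1} Φ_i)` is jointly smooth. [folklore] -/
theorem mikadoW {r : ℝ} (𝔚 : MikadoDatum r) (i : ℕ) :
    IsSmoothSpaceTimeOn (Icc 0 S.T)
      (fun t x => 𝔚.W (tildeR P S η D i t x) (P.freqNat (S.q + 1) • phiPoint D i t x)) :=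
  isSmoothSpaceTimeOn_mikado_comp 𝔚.smooth_W
    (isSmoothSpaceTimeOn_tildeR h.pos_T h.e h.vbar h.Rbar h.eta h.disp
      (fun t ht => (h.rho_pos t ht).ne') i) (h.disp i) _

/-- The principal part `w_o` (5.20) is jointly smooth. [folklore] -/
theorem principalPart (𝔚 : MikadoDatum mikadoRadius) :
    IsSmoothSpaceTimeOn (Icc 0 S.T) (BDSV.principalPart P S 𝔚 η D) :=
  IsSmoothSpaceTimeOn.sum fun i _ => (h.sqrtRhoI i).smul
    (isSmoothSpaceTimeOn_toEuclideanLin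
      (fun a b => isSmoothSpaceTimeOn_adjugate (isSmoothSpaceTimeOn_gradPhi h.pos_T h.disp i) a b)
      (h.mikadoW 𝔚 i))

/-- The corrector `w_c = w_{q+1} - w_o` is jointly smooth. [folklore] -/
theorem correctorPart (𝔚 : MikadoDatum mikadoRadius) :
    IsSmoothSpaceTimeOn (Icc 0 S.T) (BDSV.correctorPart P S 𝔚 η D) :=
  (h.perturbation 𝔚).sub (h.principalPart 𝔚)

end SmoothData

/-- Under the standing hypotheses, with `ρ_q > 0` on `[0,T]` and `c₀ > 0`, the construction data
are smooth data (`BDSV.SmoothData`): `∑_j ∫ η_j² ≥ c₀ > 0` by property (v) of the cut-offs. [folklore] -/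
theorem PerturbationHypotheses.toSmoothData {Nbar : ℕ} {Cin C₀ c₀ : ℝ} {Cη : ℕ → ℕ → ℝ}
    (H : PerturbationHypotheses P S Nbar Cin C₀) (hc₀ : 0 < c₀) (𝒟 : PerturbationData P S c₀ Cη)
    (hρ : ∀ t ∈ Icc 0 S.T, 0 < rhoQ P S t) : SmoothData P S 𝒟.cut.η 𝒟.D where
  pos_T := H.pos_T
  e := H.profile.smooth
  vbar := H.eulerReynolds.smooth_velocity
  pbar := H.eulerReynolds.smooth_pressure
  Rbar := H.eulerReynolds.smooth_stress
  eta := 𝒟.cut.smooth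
  disp i := (𝒟.flow i).smooth
  rho_pos := hρ
  mass_pos t ht := lt_of_lt_of_le hc₀ (𝒟.cut.sum_sq_ge t ht)

end Smooth

/-! ## Assembly: the three facts (and G₀) imply the energy estimate -/

section Assembly

/-- **G₀ along the common prefix** (BDSV Lemma 5.4: "`δ_{q+1}/(8λ_q^α) ≤ |ρ_q(t)| ≤ δ_{q+1}` for
all `t`", in the form without absolute value that its proof gives and that is used): under the
standing hypotheses (which contain the energy gap (5.2)), for `α < α₀ = βb(b-1)` and `a` beyond
the threshold of `BDSV.exists_threshold_four_amp` (`4δ_{q+2} ≤ δ_{q+1}λ_q^{-α}`), the bounds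
`BDSV.PerturbationHypotheses.le_rhoQ` / `.rhoQ_le` of `OnsagerBDSVPerturbationFlowBounds.lean`
hold along the prefix (with `N̄ = 0`, no constant). [cite: BuckmasterEtAl2018, Lemma 5.4 (bounds on ρ_q)] -/
theorem stageFact_rhoQ_bounds :
    StageFact fun _ P _ S _ _ _ => ∀ t ∈ Icc 0 S.T,
      amp P.β P.a P.b (S.q + 1) * freq P.a P.b S.q ^ (-P.α) / 8 ≤ rhoQ P S t ∧
        rhoQ P S t ≤ amp P.β P.a P.b (S.q + 1) := by
  intro 𝔚 c₀ hc₀ Cη β hβ hβ' b hb hb'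
  have hb0 : (0 : ℝ) < b := by linarith
  refine ⟨β * b * (b - 1), by nlinarith [mul_pos hβ hb0], fun α hα hαlt => ⟨0, fun Cin C₀ => ?_⟩⟩
  have hαb : α < 2 * β * b * (b - 1) := by nlinarith [mul_pos hβ hb0]
  obtain ⟨a₁, ha₁, h4⟩ := exists_threshold_four_amp hb hαb
  exact ⟨0, a₁, ha₁, fun a ha S H 𝒟 t ht =>
    ⟨H.le_rhoQ (h4 a ha S.q) ht, H.rhoQ_le (ha₁.le.trans ha) ht⟩⟩

variable {β α a b : ℝ}

/-- The target scale `δ_q^{1/2} δ_{q+1}^{1/2} λ_q^{1+2α} λ_{q+1}^{-1}` of Prop. 6.2 dominates the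
scale `δ_q^{1/2} δ_{q+1}^{1/2} λ_q λ_{q+1}^{-1}` of the cross term (`λ_q ≤ λ_q^{1+2α}`). [folklore] -/
theorem crossScale_le (ha : 1 ≤ a) (hα : 0 ≤ α) (q : ℕ) :
    Real.sqrt (amp β a b q) * Real.sqrt (amp β a b (q + 1)) * freq a b q * (freq a b (q + 1))⁻¹ ≤
      Real.sqrt (amp β a b q) * Real.sqrt (amp β a b (q + 1)) * freq a b q ^ (1 + 2 * α) *
        (freq a b (q + 1))⁻¹ := by
  have h1f : 1 ≤ freq a b q := le_trans (by linarith [Real.two_le_pi]) (two_pi_le_freq ha q)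
  have h1 : freq a b q ≤ freq a b q ^ (1 + 2 * α) := Real.self_le_rpow_of_one_le h1f (by linarith)
  exact mul_le_mul_of_nonneg_right
    (mul_le_mul_of_nonneg_left h1 (mul_nonneg (Real.sqrt_nonneg _) (Real.sqrt_nonneg _)))
    (inv_nonneg.2 (freq_pos ha (q + 1)).le)

/-- The target scale dominates the scale `δ_{q+1} ℓ^{-1} λ_{q+1}^{-1}` of the corrector terms:
`δ_{q+1} ℓ^{-1} = δ_{q+1}^{1/2} δ_q^{1/2} λ_q^{1+3α/2} ≤ δ_q^{1/2} δ_{q+1}^{1/2} λ_q^{1+2α}` (the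
step "`= `(2.10)′" of the source). [cite: BuckmasterEtAl2018, Prop. 6.2 (proof)] -/
theorem correctorScale_le (ha : 1 ≤ a) (hα : 0 ≤ α) (q : ℕ) :
    amp β a b (q + 1) * (mollScale β α a b q)⁻¹ * (freq a b (q + 1))⁻¹ ≤
      Real.sqrt (amp β a b q) * Real.sqrt (amp β a b (q + 1)) * freq a b q ^ (1 + 2 * α) *
        (freq a b (q + 1))⁻¹ := by
  have hA : 0 < Real.sqrt (amp β a b (q + 1)) := Real.sqrt_pos.2 (amp_pos ha _)
  have hB : 0 < Real.sqrt (amp β a b q) := Real.sqrt_pos.2 (amp_pos ha _)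
  have hF : 0 < freq a b q ^ (1 + 3 * α / 2) := Real.rpow_pos_of_pos (freq_pos ha q) _
  have hamp : amp β a b (q + 1) = Real.sqrt (amp β a b (q + 1)) * Real.sqrt (amp β a b (q + 1)) :=
    (Real.mul_self_sqrt (amp_pos ha (q + 1)).le).symm
  have hℓ : amp β a b (q + 1) * (mollScale β α a b q)⁻¹ =
      Real.sqrt (amp β a b q) * Real.sqrt (amp β a b (q + 1)) * freq a b q ^ (1 + 3 * α / 2) :=
    calc amp β a b (q + 1) * (mollScale β α a b q)⁻¹
        = amp β a b (q + 1) / Real.sqrt (amp β a b (q + 1)) *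
            (Real.sqrt (amp β a b q) * freq a b q ^ (1 + 3 * α / 2)) := by
          rw [mollScale, inv_div]
          ring
      _ = Real.sqrt (amp β a b (q + 1)) *
            (Real.sqrt (amp β a b q) * freq a b q ^ (1 + 3 * α / 2)) := by
          rw [div_eq_of_eq_mul hA.ne' hamp]
      _ = Real.sqrt (amp β a b q) * Real.sqrt (amp β a b (q + 1)) *
            freq a b q ^ (1 + 3 * α / 2) := by
          ring
  rw [hℓ]
  have h1f : 1 ≤ freq a b q := le_trans (by linarith [Real.two_le_pi]) (two_pi_le_freq ha q)
  have h1 : freq a b q ^ (1 + 3 * α / 2) ≤ freq a b q ^ (1 + 2 * α) :=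
    Real.rpow_le_rpow_of_exponent_le h1f (by linarith)
  exact mul_le_mul_of_nonneg_right
    (mul_le_mul_of_nonneg_left h1 (mul_nonneg (Real.sqrt_nonneg _) (Real.sqrt_nonneg _)))
    (inv_nonneg.2 (freq_pos ha (q + 1)).le)

/-- The target scale dominates the scale `δ_{q+1} δ_q^{1/2} λ_q λ_{q+1}^{-1}` of the principal term
(`δ_{q+1} ≤ δ_{q+1}^{1/2}` as `δ_{q+1} ≤ 1`, and `λ_q ≤ λ_q^{1+2α}`). [folklore] -/
theorem principalScale_le (ha : 1 ≤ a) (hα : 0 ≤ α) (hβ : 0 ≤ β) (q : ℕ) :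
    amp β a b (q + 1) * Real.sqrt (amp β a b q) * freq a b q * (freq a b (q + 1))⁻¹ ≤
      Real.sqrt (amp β a b q) * Real.sqrt (amp β a b (q + 1)) * freq a b q ^ (1 + 2 * α) *
        (freq a b (q + 1))⁻¹ := by
  have h0 : 0 ≤ amp β a b (q + 1) := (amp_pos ha _).le
  have h1 : amp β a b (q + 1) ≤ Real.sqrt (amp β a b (q + 1)) := by
    rw [Real.le_sqrt h0 h0]
    nlinarith [amp_le_one (b := b) ha hβ (q + 1)]
  have h1f : 1 ≤ freq a b q := le_trans (by linarith [Real.two_le_pi]) (two_pi_le_freq ha q)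
  have h2 : freq a b q ≤ freq a b q ^ (1 + 2 * α) := Real.self_le_rpow_of_one_le h1f (by linarith)
  calc amp β a b (q + 1) * Real.sqrt (amp β a b q) * freq a b q * (freq a b (q + 1))⁻¹
      = Real.sqrt (amp β a b q) * amp β a b (q + 1) * freq a b q * (freq a b (q + 1))⁻¹ := by ring
    _ ≤ Real.sqrt (amp β a b q) * Real.sqrt (amp β a b (q + 1)) * freq a b q ^ (1 + 2 * α) *
        (freq a b (q + 1))⁻¹ :=
      mul_le_mul_of_nonneg_right
        (mul_le_mul (mul_le_mul_of_nonneg_left h1 (Real.sqrt_nonneg _)) h2 (freq_pos ha q).le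
          (mul_nonneg (Real.sqrt_nonneg _) (Real.sqrt_nonneg _)))
        (inv_nonneg.2 (freq_pos ha (q + 1)).le)

/-- **The energy identity behind Prop. 6.2** (first display of the proof of Prop. 6.2 and the
split (5.28)): for smooth data,
`∫|v_{q+1}|² = ∫|v̄_q|² + 2∫ w_{q+1}·v̄_q + ∫|w_o|² + ∫(2 w_o·w_c + |w_c|²)` at every
`t ∈ [0,T]`. [cite: BuckmasterEtAl2018, Prop. 6.2 (proof, first display)] -/
theorem SmoothData.integral_norm_sq_newVelocity {P : Params} {S : Setting} {η : ℕ → ℝ → 𝕋³ → ℝ}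
    {D : ℕ → ℝ → 𝕋³ → ℝ³} (h : SmoothData P S η D) (𝔚 : MikadoDatum mikadoRadius) {t : ℝ}
    (ht : t ∈ Icc 0 S.T) :
    ∫ x, ‖BDSV.newVelocity P S 𝔚 η D t x‖ ^ 2 =
      (∫ x, ‖S.vbar t x‖ ^ 2) + 2 * (∫ x, ⟪BDSV.perturbation P S 𝔚 η D t x, S.vbar t x⟫_ℝ) +
        ((∫ x, ‖BDSV.principalPart P S 𝔚 η D t x‖ ^ 2) +
          ∫ x, (2 * ⟪BDSV.principalPart P S 𝔚 η D t x, BDSV.correctorPart P S 𝔚 η D t x⟫_ℝ +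
            ‖BDSV.correctorPart P S 𝔚 η D t x‖ ^ 2)) := by
  have hv : IsSmooth (S.vbar t) := h.vbar.isSmooth_slice ht
  have hw : IsSmooth (BDSV.perturbation P S 𝔚 η D t) := (h.perturbation 𝔚).isSmooth_slice ht
  have hwo : IsSmooth (BDSV.principalPart P S 𝔚 η D t) := (h.principalPart 𝔚).isSmooth_slice ht
  have hwc : IsSmooth (BDSV.correctorPart P S 𝔚 η D t) := (h.correctorPart 𝔚).isSmooth_slice ht
  have hpt : (fun x => ‖BDSV.newVelocity P S 𝔚 η D t x‖ ^ 2) = fun x =>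
      (‖S.vbar t x‖ ^ 2 + 2 * ⟪BDSV.perturbation P S 𝔚 η D t x, S.vbar t x⟫_ℝ) +
        ‖BDSV.perturbation P S 𝔚 η D t x‖ ^ 2 := by
    funext x
    simp only [BDSV.newVelocity]
    rw [norm_add_sq_real, real_inner_comm]
  have hpt' : (fun x => ‖BDSV.perturbation P S 𝔚 η D t x‖ ^ 2) = fun x =>
      ‖BDSV.principalPart P S 𝔚 η D t x‖ ^ 2 +
        (2 * ⟪BDSV.principalPart P S 𝔚 η D t x, BDSV.correctorPart P S 𝔚 η D t x⟫_ℝ +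
          ‖BDSV.correctorPart P S 𝔚 η D t x‖ ^ 2) := by
    funext x
    rw [BDSV.perturbation_eq_principalPart_add_correctorPart, norm_add_sq_real, add_assoc]
  have hi₁ : Integrable (fun x => ‖S.vbar t x‖ ^ 2) := hv.norm_sq.integrable
  have hi₂ : Integrable (fun x => 2 * ⟪BDSV.perturbation P S 𝔚 η D t x, S.vbar t x⟫_ℝ) :=
    (hw.inner hv).integrable.const_mul 2
  have hi₃ : Integrable (fun x => ‖BDSV.principalPart P S 𝔚 η D t x‖ ^ 2) := hwo.norm_sq.integrable
  have hi₄ : Integrable (fun x =>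
      2 * ⟪BDSV.principalPart P S 𝔚 η D t x, BDSV.correctorPart P S 𝔚 η D t x⟫_ℝ +
        ‖BDSV.correctorPart P S 𝔚 η D t x‖ ^ 2) :=
    ((hwo.inner hwc).integrable.const_mul 2).add hwc.norm_sq.integrable
  have hi₁₂ : Integrable (fun x => ‖S.vbar t x‖ ^ 2 +
      2 * ⟪BDSV.perturbation P S 𝔚 η D t x, S.vbar t x⟫_ℝ) := hi₁.add hi₂
  have hi₅ : Integrable (fun x => ‖BDSV.perturbation P S 𝔚 η D t x‖ ^ 2) := hw.norm_sq.integrable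
  have hw2 : ∫ x, ‖BDSV.perturbation P S 𝔚 η D t x‖ ^ 2 =
      (∫ x, ‖BDSV.principalPart P S 𝔚 η D t x‖ ^ 2) +
        ∫ x, (2 * ⟪BDSV.principalPart P S 𝔚 η D t x, BDSV.correctorPart P S 𝔚 η D t x⟫_ℝ +
          ‖BDSV.correctorPart P S 𝔚 η D t x‖ ^ 2) := by
    rw [hpt', integral_add hi₃ hi₄]
  rw [hpt, integral_add hi₁₂ hi₅, integral_add hi₁ hi₂, integral_const_mul, hw2]

/-- `3ρ_q(t) = e(t) - δ_{q+2}/2 - ∫|v̄_q|²` (definition of `ρ_q`, §5.2; the identity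
`∑_i ∫ tr R_{q,i} = 3ρ_q` of the proof of Prop. 6.2). [cite: BuckmasterEtAl2018, §5.2 (ρ_q)] -/
theorem three_mul_rhoQ (P : Params) (S : Setting) (t : ℝ) :
    3 * rhoQ P S t = S.e t - amp P.β P.a P.b (S.q + 2) / 2 - ∫ x, ‖S.vbar t x‖ ^ 2 := by
  rw [rhoQ]
  ring

/-- **Assembly of the energy estimate from its parts** (BDSV, proof of Prop. 6.2): with the
bounds of Lemma 5.4 on `ρ_q` (G₀: `BDSV.stageFact_rhoQ_bounds`, from the proved
`PerturbationHypotheses.le_rhoQ` / `.rhoQ_le`; it makes the construction smooth), the energy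
identity `e - ∫|v_{q+1}|² - δ_{q+2}/2 = (3ρ_q - ∫|w_o|²) - 2∫ w_{q+1}·v̄_q - ∫(2w_o·w_c + |w_c|²)`
and the three estimates G₁ (cross term), G₂ (corrector terms), G₃ (principal term) give
Prop. 6.2 with constant `4 max(C, 0)` along the common prefix, after comparing the three scales
with `δ_q^{1/2} δ_{q+1}^{1/2} λ_q^{1+2α} λ_{q+1}^{-1}`. [cite: BuckmasterEtAl2018, Prop. 6.2 (proof)] -/
theorem energyEstimate_of_parts (h₁ : energy_crossTerm) (h₂ : energy_correctorTerm)
    (h₃ : energy_principalTerm) : energyEstimate := by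
  rw [energyEstimate_iff_stageFact]
  -- monotonicity of the bodies in the constant
  have m₁ : ∀ (𝔚 : MikadoDatum mikadoRadius) (P : Params) (C C' : ℝ) (S : Setting) (c₀ : ℝ)
      (Cη : ℕ → ℕ → ℝ) (𝒟 : PerturbationData P S c₀ Cη), 1 ≤ P.a → C ≤ C' →
      (∀ t ∈ Icc 0 S.T, |∫ x, ⟪perturbation P S 𝔚 𝒟.cut.η 𝒟.D t x, S.vbar t x⟫_ℝ| ≤
        C * (Real.sqrt (amp P.β P.a P.b S.q) * Real.sqrt (amp P.β P.a P.b (S.q + 1)) *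
          freq P.a P.b S.q * (freq P.a P.b (S.q + 1))⁻¹)) →
      ∀ t ∈ Icc 0 S.T, |∫ x, ⟪perturbation P S 𝔚 𝒟.cut.η 𝒟.D t x, S.vbar t x⟫_ℝ| ≤
        C' * (Real.sqrt (amp P.β P.a P.b S.q) * Real.sqrt (amp P.β P.a P.b (S.q + 1)) *
          freq P.a P.b S.q * (freq P.a P.b (S.q + 1))⁻¹) :=
    fun 𝔚 P C C' S c₀ Cη 𝒟 ha hCC' h t ht => (h t ht).trans
      (mul_le_mul_of_nonneg_right hCC' (mul_nonneg (mul_nonneg (mul_nonneg (Real.sqrt_nonneg _)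
        (Real.sqrt_nonneg _)) (freq_pos ha _).le) (inv_nonneg.2 (freq_pos ha _).le)))
  have m₂ : ∀ (𝔚 : MikadoDatum mikadoRadius) (P : Params) (C C' : ℝ) (S : Setting) (c₀ : ℝ)
      (Cη : ℕ → ℕ → ℝ) (𝒟 : PerturbationData P S c₀ Cη), 1 ≤ P.a → C ≤ C' →
      (∀ t ∈ Icc 0 S.T, |∫ x, (2 * ⟪principalPart P S 𝔚 𝒟.cut.η 𝒟.D t x,
          correctorPart P S 𝔚 𝒟.cut.η 𝒟.D t x⟫_ℝ + ‖correctorPart P S 𝔚 𝒟.cut.η 𝒟.D t x‖ ^ 2)| ≤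
        C * (amp P.β P.a P.b (S.q + 1) * (mollScale P.β P.α P.a P.b S.q)⁻¹ *
          (freq P.a P.b (S.q + 1))⁻¹)) →
      ∀ t ∈ Icc 0 S.T, |∫ x, (2 * ⟪principalPart P S 𝔚 𝒟.cut.η 𝒟.D t x,
          correctorPart P S 𝔚 𝒟.cut.η 𝒟.D t x⟫_ℝ + ‖correctorPart P S 𝔚 𝒟.cut.η 𝒟.D t x‖ ^ 2)| ≤
        C' * (amp P.β P.a P.b (S.q + 1) * (mollScale P.β P.α P.a P.b S.q)⁻¹ *
          (freq P.a P.b (S.q + 1))⁻¹) :=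
    fun 𝔚 P C C' S c₀ Cη 𝒟 ha hCC' h t ht => (h t ht).trans
      (mul_le_mul_of_nonneg_right hCC' (mul_nonneg (mul_nonneg (amp_pos ha _).le
        (inv_nonneg.2 (mollScale_pos ha _).le)) (inv_nonneg.2 (freq_pos ha _).le)))
  have m₃ : ∀ (𝔚 : MikadoDatum mikadoRadius) (P : Params) (C C' : ℝ) (S : Setting) (c₀ : ℝ)
      (Cη : ℕ → ℕ → ℝ) (𝒟 : PerturbationData P S c₀ Cη), 1 ≤ P.a → C ≤ C' →
      (∀ t ∈ Icc 0 S.T, |(∫ x, ‖principalPart P S 𝔚 𝒟.cut.η 𝒟.D t x‖ ^ 2) - 3 * rhoQ P S t| ≤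
        C * (amp P.β P.a P.b (S.q + 1) * Real.sqrt (amp P.β P.a P.b S.q) * freq P.a P.b S.q *
          (freq P.a P.b (S.q + 1))⁻¹)) →
      ∀ t ∈ Icc 0 S.T, |(∫ x, ‖principalPart P S 𝔚 𝒟.cut.η 𝒟.D t x‖ ^ 2) - 3 * rhoQ P S t| ≤
        C' * (amp P.β P.a P.b (S.q + 1) * Real.sqrt (amp P.β P.a P.b S.q) * freq P.a P.b S.q *
          (freq P.a P.b (S.q + 1))⁻¹) :=
    fun 𝔚 P C C' S c₀ Cη 𝒟 ha hCC' h t ht => (h t ht).trans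
      (mul_le_mul_of_nonneg_right hCC' (mul_nonneg (mul_nonneg (mul_nonneg (amp_pos ha _).le
        (Real.sqrt_nonneg _)) (freq_pos ha _).le) (inv_nonneg.2 (freq_pos ha _).le)))
  have hK := ((stageFact_rhoQ_bounds.and h₁ (fun _ _ _ _ _ _ _ _ _ _ h => h) m₁).and h₂
    (fun 𝔚 P C C' S c₀ Cη 𝒟 ha hle h => ⟨h.1, m₁ 𝔚 P C C' S c₀ Cη 𝒟 ha hle h.2⟩) m₂).and h₃
    (fun 𝔚 P C C' S c₀ Cη 𝒟 ha hle h =>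
      ⟨⟨h.1.1, m₁ 𝔚 P C C' S c₀ Cη 𝒟 ha hle h.1.2⟩, m₂ 𝔚 P C C' S c₀ Cη 𝒟 ha hle h.2⟩) m₃
  refine hK.mono (fun C => 4 * max C 0) ?_
  rintro 𝔚 P C S c₀ Cη 𝒟 hc₀ hβ - - hα ha ⟨Nbar, Cin, C₀, H⟩ ⟨⟨⟨hρ, hcross⟩, hcorr⟩, hprin⟩ t ht
  have ha1 : 1 ≤ P.a := ha.le
  -- `ρ_q > 0`, hence smooth data
  have hρpos : ∀ s ∈ Icc 0 S.T, 0 < rhoQ P S s := fun s hs =>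
    lt_of_lt_of_le (div_pos (mul_pos (amp_pos ha1 _) (Real.rpow_pos_of_pos (freq_pos ha1 _) _))
      (by norm_num)) (hρ s hs).1
  have hSD : SmoothData P S 𝒟.cut.η 𝒟.D := H.toSmoothData hc₀ 𝒟 hρpos
  -- the energy identity
  rw [hSD.integral_norm_sq_newVelocity 𝔚 ht]
  -- the three estimates and the scale comparisons
  set E := Real.sqrt (amp P.β P.a P.b S.q) * Real.sqrt (amp P.β P.a P.b (S.q + 1)) *
    freq P.a P.b S.q ^ (1 + 2 * P.α) * (freq P.a P.b (S.q + 1))⁻¹ with hE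
  have hE0 : 0 ≤ E := energyScale_nonneg ha1 S.q
  have hC : C ≤ max C 0 := le_max_left _ _
  have hC0 : 0 ≤ max C 0 := le_max_right _ _
  have hs₁ : C * (Real.sqrt (amp P.β P.a P.b S.q) * Real.sqrt (amp P.β P.a P.b (S.q + 1)) *
      freq P.a P.b S.q * (freq P.a P.b (S.q + 1))⁻¹) ≤ max C 0 * E :=
    (mul_le_mul_of_nonneg_right hC (mul_nonneg (mul_nonneg (mul_nonneg (Real.sqrt_nonneg _)
      (Real.sqrt_nonneg _)) (freq_pos ha1 _).le) (inv_nonneg.2 (freq_pos ha1 _).le))).trans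
      (mul_le_mul_of_nonneg_left (crossScale_le ha1 hα.le S.q) hC0)
  have hs₂ : C * (amp P.β P.a P.b (S.q + 1) * (mollScale P.β P.α P.a P.b S.q)⁻¹ *
      (freq P.a P.b (S.q + 1))⁻¹) ≤ max C 0 * E :=
    (mul_le_mul_of_nonneg_right hC (mul_nonneg (mul_nonneg (amp_pos ha1 _).le
      (inv_nonneg.2 (mollScale_pos ha1 _).le)) (inv_nonneg.2 (freq_pos ha1 _).le))).trans
      (mul_le_mul_of_nonneg_left (correctorScale_le ha1 hα.le S.q) hC0)
  have hs₃ : C * (amp P.β P.a P.b (S.q + 1) * Real.sqrt (amp P.β P.a P.b S.q) * freq P.a P.b S.q *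
      (freq P.a P.b (S.q + 1))⁻¹) ≤ max C 0 * E :=
    (mul_le_mul_of_nonneg_right hC (mul_nonneg (mul_nonneg (mul_nonneg (amp_pos ha1 _).le
      (Real.sqrt_nonneg _)) (freq_pos ha1 _).le) (inv_nonneg.2 (freq_pos ha1 _).le))).trans
      (mul_le_mul_of_nonneg_left (principalScale_le ha1 hα.le hβ.le S.q) hC0)
  obtain ⟨hX₁, hX₂⟩ := abs_le.mp ((hprin t ht).trans hs₃)
  obtain ⟨hI₁, hI₂⟩ := abs_le.mp ((hcross t ht).trans hs₁)
  obtain ⟨hJ₁, hJ₂⟩ := abs_le.mp ((hcorr t ht).trans hs₂)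
  have h3ρ := three_mul_rhoQ P S t
  rw [abs_le]
  constructor <;> nlinarith [h3ρ, hX₁, hX₂, hI₁, hI₂, hJ₁, hJ₂, hE0, hC0]

end Assembly

end BDSV

end Literature.Analysis.FluidPDE
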